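import Summits.BirchSwinnertonDyer.BirchSwinnertonDyer.Theorems.BiquadraticEisensteinDescentHeegnerTwistCouplingInSupplySqrtTwoCell
import Summits.BirchSwinnertonDyer.BirchSwinnertonDyer.Theorems.BiquadraticEisensteinDescentHeegnerTwistCouplingInSupplySqrtTwoCellFifteenLocal
import HarnessLib

set_option linter.dupNamespace false -- `Summit.BirchSwinnertonDyer.BirchSwinnertonDyer.Theorems.…` (summit = sub)
set_option autoImplicit false

/-!
# Crux `HeegnerTwistCouplingInSupply` (stmt-BirchSwinnertonDyer-21381) — card `sqrt2-isogeny-heegner-pin`, CELL-15 PROVED (part 2):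
# the complete `2`-isogeny descent of `B_{−m} : y² = x³ − 4m x² + 2m² x` (`j = 8000`, CM by `ℤ[√−2]`) for `m = p·m′`,
# `p ≡ 15 (mod 16)` prime, `m′ > 0` square-free with every prime factor `≡ ±3 (mod 8)`, `p ∤ m′`, `(m′/p) = −1`:
# `S^{(φ̂)}, S^{(φ)} ⊆ {1, 2}`, `rank B_{−m}(ℚ) = 0`, `Ш(B_{−m}/ℚ)[2] = 0`, `corank_{ℤ₂} Sel_{2^∞}(B_{−m}/ℚ) = 0` — UNCONDITIONAL

Route `BiquadraticEisensteinDescent` (cell `pub/bsd-wall`, width seat `bsd-wall-cm-bed-w2` g12; `--supports` 21381, helper). Uses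
`…SqrtTwoCell` (bed-w1 g10: generic layer, CELL-5 pattern) and `…SqrtTwoCellFifteenLocal` (this seat: rootless reduction, the
`2 ± √2` law at `p`, the `2`-adic classes `p, 2p`) BY NAME, and runs the tree's PROVED descent via two-isogeny
(`twoIsogenySelmerGroup`, `two_pow_twoIsogenySelmerRank_add_eq` = AEC X.4.2(a) counted, `forall_mem_sha_two_smul_eq_zero_of_halfModel`
= AEC III.6.1) on the card's CELL-15:

* §2 `mem_twoIsogenySelmerGroup_phiHat` / `…_phi`: **`S(−4m, 2m²) ⊆ {1, 2}`** and **`S(8m, 8m²) ⊆ {1, 2}`** for `m = pm′` — a class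
  with an odd prime factor `r ≠ p` dies `r`-adically (`(2/r) = −1`), `φ̂`-classes `p, 2p` and `φ`-classes `−p, −2p` die `p`-adically
  (`2 ± √2`), `φ`-classes `−1, −2, p, 2p` die `2`-adically, negative `φ̂`-classes die over `ℝ`; `1 = δ(O)`, `2 = δ(T)` remain;
* §3 ★ `rank_eq_zero_and_sha_two` — **`rank B_{−m}(ℚ) = 0` and `Ш(B_{−m}/ℚ)[2] = 0`**; ★ `selmerCorank_two_eq_zero` —
  **`corank_{ℤ₂} Sel_{2^∞}(B_{−m}/ℚ) = 0`** (Greenberg's identity `selmerCorank_eq_mordellWeilRank_add_holds`, `shaCorank_eq_zero_of_forall`);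
  `not_isSquare_of_jacobiSym_eq_neg_one` (the hypothesis `(m′/p) = −1` as the pins state it).

PARI cross-check (card, kit j311876 (c)): `p ≡ 15 (16)`: 936/936 such twists clean; `p ≡ 7 (16)`: 0/1045 (the mod-16 law is sharp).
HONEST FRAMING: unconditional arithmetic of one explicit CM family; nothing about `L`-values here (the corner file adds Burungale–Tian
+ Deuring–Hecke for the card's targets T_B/T_C); the crux (all CM `W` of analytic rank one; residual C⁺) and BSD are NOT proved by any
of this. THEOREMS ONLY; supports stmt-BirchSwinnertonDyer-21381.
-/

noncomputable section

open scoped Classical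

namespace Summit.BirchSwinnertonDyer.BirchSwinnertonDyer.Theorems.BiquadraticEisensteinDescentHeegnerTwistCouplingInSupplySqrtTwoCellFifteen

open _root_.WeierstrassCurve Literature.NumberTheory.EllipticCurves
open Literature.NumberTheory.EllipticCurves.Zywina2025 (exists_padicInt_of_isSoluble)
open Summit.BirchSwinnertonDyer.BirchSwinnertonDyer.Theorems.GoldfeldGoodTwists
  (not_isSoluble_two_of_zmodPow mordellWeilRank_congr forall_mem_sha_two_congr)
open Summit.BirchSwinnertonDyer.BirchSwinnertonDyer.Theorems.BiquadraticEisensteinDescentHeegnerTwistCouplingInSupplySqrtTwoCell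
open Summit.BirchSwinnertonDyer.BirchSwinnertonDyer.Theorems.BiquadraticEisensteinDescentHeegnerTwistCouplingInSupplySqrtTwoLaw
  (twoPlusSqrtTwoIsSquare)

open Summit.BirchSwinnertonDyer.BirchSwinnertonDyer.Theorems.BiquadraticEisensteinDescentHeegnerTwistCouplingInSupplySqrtTwoCellFifteenLocal

/-! ## §2 The two Selmer sets of `B_{−pm′}`: `S(−4m, 2m²) ⊆ {1, 2}` and `S(8m, 8m²) ⊆ {1, 2}` (`m = p m′`) -/

section Selmer

variable {p : ℕ} {m m' : ℤ}

/-- `m = p m′` is positive, square-free and odd under the CELL-15 hypotheses. [folklore] -/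
theorem pos_squarefree_odd (hp : p.Prime) (hp2 : p ≠ 2) (hm : m = p * m') (hm'0 : 0 < m') (hm' : Squarefree m')
    (hpm' : ¬ (p : ℤ) ∣ m') (hm'8 : ∀ r : ℕ, r.Prime → (r : ℤ) ∣ m' → r % 8 = 3 ∨ r % 8 = 5) :
    0 < m ∧ Squarefree m ∧ Odd m := by
  have hp0 : (0 : ℤ) < p := by exact_mod_cast hp.pos
  refine ⟨by rw [hm]; positivity, ?_, ?_⟩
  · rw [hm, ← Int.squarefree_natAbs, Int.natAbs_mul, Int.natAbs_natCast]
    have hcop : Nat.Coprime p m'.natAbs := by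
      rw [Nat.Prime.coprime_iff_not_dvd hp]
      exact fun h => hpm' (Int.natCast_dvd.mpr h)
    rw [Nat.squarefree_mul hcop]
    exact ⟨hp.squarefree, Int.squarefree_natAbs.mpr hm'⟩
  · rw [hm]
    refine Odd.mul ?_ (odd_of_prime_factors_mod_eight hm'8)
    exact_mod_cast hp.odd_of_ne_two hp2

/-- An odd prime `r ≠ p` dividing `m = p m′` divides `m′`. [folklore] -/
theorem dvd_of_dvd_mul_prime {r : ℕ} (hr : r.Prime) (hp : p.Prime) (hrp : r ≠ p) (hm : m = p * m')
    (hrm : (r : ℤ) ∣ m) : (r : ℤ) ∣ m' := by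
  rw [hm] at hrm
  refine ((Nat.prime_iff_prime_int.mp hr).dvd_or_dvd hrm).resolve_left fun h => hrp ?_
  exact (Nat.prime_dvd_prime_iff_eq hr hp).mp (Int.natCast_dvd_natCast.mp h)

/-- Shape of a square-free `d` whose prime factors lie in `{2, p}` and which `p` divides: `d ∈ {±p, ±2p}`. [folklore] -/
theorem eq_of_squarefree_of_prime_factors {d : ℤ} (hp : p.Prime) (hsq : Squarefree d) (hpd : (p : ℤ) ∣ d)
    (h : ∀ q : ℕ, q.Prime → (q : ℤ) ∣ d → q = 2 ∨ q = p) :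
    d = p ∨ d = 2 * p ∨ d = -p ∨ d = -(2 * p) := by
  obtain ⟨d₂, rfl⟩ := hpd
  have hpZ : Prime (p : ℤ) := Nat.prime_iff_prime_int.mp hp
  have hpd₂ : ¬ (p : ℤ) ∣ d₂ := fun ⟨k, hk⟩ => hpZ.not_unit (by
    have := hsq p ⟨k, by rw [hk]; ring⟩
    simpa using this)
  have hsq₂ : Squarefree d₂ := fun x hx => hsq x (hx.trans (Dvd.intro_left _ rfl))
  have habs := natAbs_eq_one_or_two_of_squarefree hsq₂ fun q hq hqd =>
    ((h q hq (hqd.trans (Dvd.intro_left _ rfl))).resolve_right fun hqp => hpd₂ (by rw [← hqp]; exact hqd))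
  rcases Int.natAbs_eq d₂ with hpos | hneg <;> rcases habs with h1 | h2
  · exact Or.inl (by rw [hpos, h1]; simp)
  · exact Or.inr (Or.inl (by rw [hpos, h2]; push_cast; ring))
  · exact Or.inr (Or.inr (Or.inl (by rw [hneg, h1]; simp)))
  · exact Or.inr (Or.inr (Or.inr (by rw [hneg, h2]; push_cast; ring)))

/-- Negative classes of `S(−4m, 2m²)` (`m > 0`) die over `ℝ`: all three coefficients of `d u⁴ − 4m u²z² + (2m²/d) z⁴` are
negative. [cite: SilvermanAEC2009, Example X.4.10 («if d < 0, then clearly C′_d(ℝ) = ∅»)] -/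
theorem false_of_neg_of_isLocallySoluble (hm0 : 0 < m) {d : ℤ} (hd0 : d < 0) (hdvd : d ∣ 2 * m ^ 2)
    (hloc : (twoIsogenyQuartic (-4 * m) d (2 * m ^ 2 / d)).IsLocallySoluble) : False := by
  have hmul : d * (2 * m ^ 2 / d) = 2 * m ^ 2 := Int.mul_ediv_cancel' hdvd
  have hd'0 : 2 * m ^ 2 / d < 0 := by
    by_contra hq
    push Not at hq
    nlinarith [mul_nonneg (neg_pos.mpr hd0).le hq, mul_pos hm0 hm0]
  exact not_isSoluble_real_twoIsogenyQuartic_of_neg hd0 hd'0 (by omega) hloc.1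

/-- **CELL-15, `φ̂`-side: `S(−4m, 2m²) ⊆ {1, 2}`** for `m = p m′`, `p ≡ 15 (mod 16)` prime, `m′ > 0` square-free, `p ∤ m′`, every
prime factor of `m′` `≡ ±3 (mod 8)`, `(m′/p) = −1`: a class with an odd prime factor `r ≠ p` dies `r`-adically (`(2/r) = −1`,
`…SqrtTwoCell.not_isSoluble_padic_of_prime_factor`), the classes `p, 2p` die `p`-adically (`2 ± √2` law), negative classes die
over `ℝ`; `1 = δ(O)` and `2 ≡ 2m² = δ(T)` remain. [cite: SilvermanAEC2009, Prop. X.4.9 and Remark X.4.9.1] -/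
theorem mem_twoIsogenySelmerGroup_phiHat (hp : p.Prime) (hp16 : p % 16 = 15) (hm : m = p * m') (hm'0 : 0 < m')
    (hm' : Squarefree m') (hpm' : ¬ (p : ℤ) ∣ m') (hm'8 : ∀ r : ℕ, r.Prime → (r : ℤ) ∣ m' → r % 8 = 3 ∨ r % 8 = 5)
    (hJ : ¬ IsSquare (m' : ZMod p)) {d : ℤ} (h : d ∈ twoIsogenySelmerGroup (-4 * m) (2 * m ^ 2)) : d = 1 ∨ d = 2 := by
  haveI : Fact p.Prime := ⟨hp⟩
  have hp2 : p ≠ 2 := by rintro rfl; omega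
  obtain ⟨hm0, hmsq, -⟩ := pos_squarefree_odd hp hp2 hm hm'0 hm' hpm' hm'8
  have hp0 : (p : ℤ) ≠ 0 := by exact_mod_cast hp.ne_zero
  have hb : (2 * m ^ 2 : ℤ) ≠ 0 := by positivity
  obtain ⟨hsq, hdvd, hloc⟩ := (mem_twoIsogenySelmerGroup_iff hb).mp h
  by_cases hodd : ∃ r : ℕ, r.Prime ∧ r ≠ 2 ∧ r ≠ p ∧ (r : ℤ) ∣ d
  · obtain ⟨r, hr, hr2, hrp, hrd⟩ := hodd
    exfalso
    haveI : Fact r.Prime := ⟨hr⟩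
    have hrm : (r : ℤ) ∣ m := dvd_of_prime_dvd_of_dvd_mul_sq hr hr2 (Or.inl rfl) hrd hdvd
    exact not_isSoluble_padic_of_prime_factor (hm'8 r hr (dvd_of_dvd_mul_prime hr hp hrp hm hrm)) (α := -4) (β := 2)
      (c := 2) (by norm_num) (by simpa using not_dvd_two_pow_of_odd_prime hr hr2 (k := 1)) hmsq hrm hsq hrd hdvd
      (by simpa [neg_mul] using hloc.2 r)
  · push Not at hodd
    by_cases hpd : (p : ℤ) ∣ d
    · -- `d ∈ {±p, ±2p}`
      obtain ⟨x, hx⟩ := twoPlusSqrtTwoIsSquare p hp hp16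
      obtain ⟨h1, h2⟩ := not_isSoluble_padic_hat_at_p hp2 hx hm hJ
      rcases eq_of_squarefree_of_prime_factors hp hsq hpd (fun q hqP hqd => by
        by_contra hq; push Not at hq; exact hodd q hqP hq.1 hq.2 hqd) with rfl | rfl | rfl | rfl
      · exfalso
        refine h1 ?_
        have := hloc.2 p
        rwa [show (2 * m ^ 2 : ℤ) / p = 2 * p * m' ^ 2 by
          rw [show (2 * m ^ 2 : ℤ) = p * (2 * p * m' ^ 2) by rw [hm]; ring]
          exact Int.mul_ediv_cancel_left _ hp0] at this
      · exfalso
        refine h2 ?_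
        have := hloc.2 p
        rwa [show (2 * m ^ 2 : ℤ) / (2 * p) = p * m' ^ 2 by
          rw [show (2 * m ^ 2 : ℤ) = (2 * p) * (p * m' ^ 2) by rw [hm]; ring]
          exact Int.mul_ediv_cancel_left _ (mul_ne_zero two_ne_zero hp0)] at this
      · exact (false_of_neg_of_isLocallySoluble hm0 (by simp [hp.pos]) hdvd hloc).elim
      · exact (false_of_neg_of_isLocallySoluble hm0 (by simp [hp.pos]) hdvd hloc).elim
    · -- only prime factor `2`
      have habs := natAbs_eq_one_or_two_of_squarefree hsq fun q hq hqd => by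
        by_contra hq2
        by_cases hqp : q = p
        · exact hpd (by rw [← hqp]; exact hqd)
        · exact hodd q hq hq2 hqp hqd
      rcases Int.natAbs_eq d with hpos | hneg
      · rcases habs with h1 | h2 <;> omega
      · exact (false_of_neg_of_isLocallySoluble hm0 (by rcases habs with h1 | h2 <;> omega) hdvd hloc).elim

/-- **CELL-15, `φ`-side: `S(8m, 8m²) ⊆ {1, 2}`** (same hypotheses): a class with an odd prime factor `r ≠ p` dies `r`-adically
(`(2/r) = −1`), `−1, −2` die `2`-adically (`m` odd; `…SqrtTwoCell`), `−p, −2p` die `p`-adically (`2 ± √2` law), `p, 2p` die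
`2`-adically (`p ≡ 7 (mod 8)`); `1` and `2 ≡ 8m²` remain. [cite: SilvermanAEC2009, Prop. X.4.9] -/
theorem mem_twoIsogenySelmerGroup_phi (hp : p.Prime) (hp16 : p % 16 = 15) (hm : m = p * m') (hm'0 : 0 < m')
    (hm' : Squarefree m') (hpm' : ¬ (p : ℤ) ∣ m') (hm'8 : ∀ r : ℕ, r.Prime → (r : ℤ) ∣ m' → r % 8 = 3 ∨ r % 8 = 5)
    (hJ : ¬ IsSquare (m' : ZMod p)) {d : ℤ} (h : d ∈ twoIsogenySelmerGroup (8 * m) (8 * m ^ 2)) : d = 1 ∨ d = 2 := by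
  haveI : Fact p.Prime := ⟨hp⟩
  haveI : Fact (Nat.Prime 2) := ⟨Nat.prime_two⟩
  have hp2 : p ≠ 2 := by rintro rfl; omega
  obtain ⟨hm0, hmsq, hmodd⟩ := pos_squarefree_odd hp hp2 hm hm'0 hm' hpm' hm'8
  have hm'odd : Odd m' := odd_of_prime_factors_mod_eight hm'8
  have hp0 : (p : ℤ) ≠ 0 := by exact_mod_cast hp.ne_zero
  have hp8 : (p : ℤ) % 8 = 7 := by omega
  have hb : (8 * m ^ 2 : ℤ) ≠ 0 := by positivity
  obtain ⟨hsq, hdvd, hloc⟩ := (mem_twoIsogenySelmerGroup_iff hb).mp h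
  by_cases hodd : ∃ r : ℕ, r.Prime ∧ r ≠ 2 ∧ r ≠ p ∧ (r : ℤ) ∣ d
  · obtain ⟨r, hr, hr2, hrp, hrd⟩ := hodd
    exfalso
    haveI : Fact r.Prime := ⟨hr⟩
    have hrm : (r : ℤ) ∣ m := dvd_of_prime_dvd_of_dvd_mul_sq hr hr2 (Or.inr rfl) hrd hdvd
    exact not_isSoluble_padic_of_prime_factor (hm'8 r hr (dvd_of_dvd_mul_prime hr hp hrp hm hrm)) (α := 8) (β := 8)
      (c := 4) (by norm_num) (by simpa using not_dvd_two_pow_of_odd_prime hr hr2 (k := 2)) hmsq hrm hsq hrd hdvd (hloc.2 r)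
  · push Not at hodd
    by_cases hpd : (p : ℤ) ∣ d
    · -- `d ∈ {±p, ±2p}`
      obtain ⟨x, hx⟩ := twoPlusSqrtTwoIsSquare p hp hp16
      obtain ⟨h1, h2⟩ := not_isSoluble_padic_prime_at_p hp2 hx hm hJ
      obtain ⟨h3, h4⟩ := not_isSoluble_two_p_and_two_p hp8 hm hm'odd
      have e8 : (8 * m ^ 2 : ℤ) / p = 8 * p * m' ^ 2 := by
        rw [show (8 * m ^ 2 : ℤ) = p * (8 * p * m' ^ 2) by rw [hm]; ring]
        exact Int.mul_ediv_cancel_left _ hp0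
      have e4 : (8 * m ^ 2 : ℤ) / (2 * p) = 4 * p * m' ^ 2 := by
        rw [show (8 * m ^ 2 : ℤ) = (2 * p) * (4 * p * m' ^ 2) by rw [hm]; ring]
        exact Int.mul_ediv_cancel_left _ (mul_ne_zero two_ne_zero hp0)
      rcases eq_of_squarefree_of_prime_factors hp hsq hpd (fun q hqP hqd => by
        by_contra hq; push Not at hq; exact hodd q hqP hq.1 hq.2 hqd) with rfl | rfl | rfl | rfl
      · exact (h3 (by simpa only [e8] using hloc.2 2)).elim
      · exact (h4 (by simpa only [e4] using hloc.2 2)).elim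
      · exact (h1 (by simpa only [Int.ediv_neg, e8] using hloc.2 p)).elim
      · exact (h2 (by simpa only [Int.ediv_neg, e4] using hloc.2 p)).elim
    · -- only prime factor `2`
      have habs := natAbs_eq_one_or_two_of_squarefree hsq fun q hq hqd => by
        by_contra hq2
        by_cases hqp : q = p
        · exact hpd (by rw [← hqp]; exact hqd)
        · exact hodd q hq hq2 hqp hqd
      rcases Int.natAbs_eq d with hpos | hneg
      · rcases habs with h1 | h2 <;> omega
      · exfalso
        rcases habs with h1 | h2
        · have hd1 : d = -1 := by omega
          subst hd1
          have h2' := hloc.2 2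
          rw [Int.ediv_neg, Int.ediv_one] at h2'
          exact not_isSoluble_two_neg_one hmodd h2'
        · have hd2 : d = -2 := by omega
          subst hd2
          have h2' := hloc.2 2
          rw [Int.ediv_neg, show (8 * m ^ 2 : ℤ) = 2 * (4 * m ^ 2) by ring,
            Int.mul_ediv_cancel_left _ (two_ne_zero)] at h2'
          exact not_isSoluble_two_neg_two hmodd h2'

/-- `#S(−4m, 2m²) ≤ 2` on CELL-15. [cite: SilvermanAEC2009, Prop. X.4.9] -/
theorem card_twoIsogenySelmerGroup_le (hp : p.Prime) (hp16 : p % 16 = 15) (hm : m = p * m') (hm'0 : 0 < m')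
    (hm' : Squarefree m') (hpm' : ¬ (p : ℤ) ∣ m') (hm'8 : ∀ r : ℕ, r.Prime → (r : ℤ) ∣ m' → r % 8 = 3 ∨ r % 8 = 5)
    (hJ : ¬ IsSquare (m' : ZMod p)) : (twoIsogenySelmerGroup (-4 * m) (2 * m ^ 2)).card ≤ 2 :=
  le_trans (Finset.card_le_card fun d hd => by
    have := mem_twoIsogenySelmerGroup_phiHat hp hp16 hm hm'0 hm' hpm' hm'8 hJ hd
    simp only [Finset.mem_insert, Finset.mem_singleton]
    exact this) (Finset.card_le_two (a := (1 : ℤ)) (b := 2))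

/-- `#S′(−4m, 2m²) = #S(8m, 8m²) ≤ 2` on CELL-15. [cite: SilvermanAEC2009, Prop. X.4.9] -/
theorem card_twoIsogenySelmerGroup'_le (hp : p.Prime) (hp16 : p % 16 = 15) (hm : m = p * m') (hm'0 : 0 < m')
    (hm' : Squarefree m') (hpm' : ¬ (p : ℤ) ∣ m') (hm'8 : ∀ r : ℕ, r.Prime → (r : ℤ) ∣ m' → r % 8 = 3 ∨ r % 8 = 5)
    (hJ : ¬ IsSquare (m' : ZMod p)) : (twoIsogenySelmerGroup' (-4 * m) (2 * m ^ 2)).card ≤ 2 := by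
  rw [twoIsogenySelmerGroup'_B]
  exact le_trans (Finset.card_le_card fun d hd => by
    have := mem_twoIsogenySelmerGroup_phi hp hp16 hm hm'0 hm' hpm' hm'8 hJ hd
    simp only [Finset.mem_insert, Finset.mem_singleton]
    exact this) (Finset.card_le_two (a := (1 : ℤ)) (b := 2))

end Selmer

/-! ## §3 `rank B_{−m}(ℚ) = 0`, `Ш(B_{−m}/ℚ)[2] = 0`, `corank_{ℤ₂} Sel_{2^∞}(B_{−m}/ℚ) = 0` on CELL-15 -/

section RankZero

variable {p : ℕ} {m m' : ℤ}

/-- Arithmetic core: `2^{r+2}·(n₁ n₂) ≤ 4` with `n₁ n₂ ≠ 0` forces `r = 0`, `n₁ = n₂ = 1`. [folklore] -/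
private theorem rank_zero_arith {r n₁ n₂ : ℕ} (h4 : 2 ^ (r + 2) * (n₁ * n₂) ≤ 4) (hpos : 0 < 2 ^ (r + 2) * (n₁ * n₂)) :
    r = 0 ∧ n₁ = 1 ∧ n₂ = 1 := by
  have hn : 0 < n₁ * n₂ := Nat.pos_of_mul_pos_left hpos |> fun h => Nat.pos_of_ne_zero (by
    rintro h0; rw [h0, mul_zero] at hpos; exact lt_irrefl 0 hpos)
  have hn₁ : 0 < n₁ := Nat.pos_of_mul_pos_right hn |> fun _ => Nat.pos_of_ne_zero (by rintro rfl; simp at hn)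
  have hn₂ : 0 < n₂ := Nat.pos_of_ne_zero (by rintro rfl; simp at hn)
  have h2 : 2 ^ (r + 2) ≤ 4 := le_trans (Nat.le_mul_of_pos_right _ hn) h4
  have hr : r = 0 := by
    by_contra hr
    have h8 : 2 ^ 3 ≤ 2 ^ (r + 2) := Nat.pow_le_pow_right (by norm_num) (by omega)
    omega
  subst hr
  norm_num at h4
  refine ⟨rfl, ?_, ?_⟩ <;> nlinarith

/-- ★ **CELL-15: `rank B_{−m}(ℚ) = 0` and `Ш(B_{−m}/ℚ)[2] = 0`** for `B_{−m} : y² = x³ − 4m x² + 2m² x`, `m = p m′` with `p ≡ 15 (16)`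
prime, `m′ > 0` square-free, `p ∤ m′`, every prime factor of `m′` `≡ ±3 (mod 8)` and `(m′/p) = −1` — UNCONDITIONAL: counted Kummer
sequences `#S·#S′ = 2^{rank+2}·#Ш(V₀)[Ξ]·#Ш(B)[Ξ]` (`two_pow_twoIsogenySelmerRank_add_eq`, AEC X.4.2(a)) with `#S, #S′ ≤ 2`, then
`forall_mem_sha_two_smul_eq_zero_of_halfModel` (AEC III.6.1). (Card: PARI 936/936 clean for `p ≡ 15 (16)`, versus 0/1045 for
`p ≡ 7 (16)`.) [cite: SilvermanAEC2009, Thm. X.4.2(a), Prop. X.4.9, Example X.4.10] -/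
theorem rank_eq_zero_and_sha_two (hp : p.Prime) (hp16 : p % 16 = 15) (hm : m = p * m') (hm'0 : 0 < m')
    (hm' : Squarefree m') (hpm' : ¬ (p : ℤ) ∣ m') (hm'8 : ∀ r : ℕ, r.Prime → (r : ℤ) ∣ m' → r % 8 = 3 ∨ r % 8 = 5)
    (hJ : ¬ IsSquare (m' : ZMod p)) :
    (⟨0, -4 * (m : ℚ), 0, 2 * (m : ℚ) ^ 2, 0⟩ : WeierstrassCurve ℚ).mordellWeilRank = 0 ∧
      ∀ c ∈ (⟨0, -4 * (m : ℚ), 0, 2 * (m : ℚ) ^ 2, 0⟩ : WeierstrassCurve ℚ).sha, 2 • c = 0 → c = 0 := by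
  have hp2 : p ≠ 2 := by rintro rfl; omega
  have hm0 : 0 < m := (pos_squarefree_odd hp hp2 hm hm'0 hm' hpm' hm'8).1
  have hab := hab_B hm0.ne'
  haveI := isElliptic_halfModel hab
  haveI := isElliptic_mk_of_ne_zero (F := ℚ) hab
  haveI := isElliptic_B hm0.ne'
  have key := two_pow_twoIsogenySelmerRank_add_eq hab
  have h4 : 2 ^ (twoIsogenySelmerRank (-4 * m) (2 * m ^ 2) + twoIsogenySelmerRank' (-4 * m) (2 * m ^ 2)) ≤ 4 := by
    rw [pow_add, two_pow_twoIsogenySelmerRank_eq_card hab, two_pow_twoIsogenySelmerRank'_eq_card hab]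
    exact Nat.mul_le_mul (card_twoIsogenySelmerGroup_le hp hp16 hm hm'0 hm' hpm' hm'8 hJ)
      (card_twoIsogenySelmerGroup'_le hp hp16 hm hm'0 hm' hpm' hm'8 hJ)
  rw [key] at h4
  obtain ⟨hr, h₁, h₂⟩ := rank_zero_arith h4 (by rw [← key]; exact pow_pos two_pos _)
  have hsha := forall_mem_sha_two_smul_eq_zero_of_halfModel (AddSubgroup.eq_bot_of_card_eq _ h₁)
    (AddSubgroup.eq_bot_of_card_eq _ h₂)
  refine ⟨?_, forall_mem_sha_two_congr (lit_B m).symm hsha⟩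
  rw [← mordellWeilRank_congr (lit_B m)]
  exact hr

/-- ★ **CELL-15, corank form: `corank_{ℤ₂} Sel_{2^∞}(B_{−m}/ℚ) = 0`** (same hypotheses): Greenberg's identity
`selmerCorank_eq_mordellWeilRank_add_holds` with `rank = 0` and `Ш[2] = 0 ⇒ corank Ш[2^∞] = 0` (`shaCorank_eq_zero_of_forall`).
This is the hypothesis of Burungale–Tian's rank-zero `2`-converse. The instance argument is `…SqrtTwoCell.isElliptic_B`.
[cite: SilvermanAEC2009, Thm. X.4.2(a) and Prop. X.4.9] [cite: Greenberg1999, §1] -/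
theorem selmerCorank_two_eq_zero (hp : p.Prime) (hp16 : p % 16 = 15) (hm : m = p * m') (hm'0 : 0 < m')
    (hm' : Squarefree m') (hpm' : ¬ (p : ℤ) ∣ m') (hm'8 : ∀ r : ℕ, r.Prime → (r : ℤ) ∣ m' → r % 8 = 3 ∨ r % 8 = 5)
    (hJ : ¬ IsSquare (m' : ZMod p))
    [hE : (⟨0, -4 * (m : ℚ), 0, 2 * (m : ℚ) ^ 2, 0⟩ : WeierstrassCurve ℚ).IsElliptic] :
    (⟨0, -4 * (m : ℚ), 0, 2 * (m : ℚ) ^ 2, 0⟩ : WeierstrassCurve ℚ).selmerCorank 2 = 0 := by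
  haveI : Fact (Nat.Prime 2) := ⟨Nat.prime_two⟩
  obtain ⟨hr, hsha⟩ := rank_eq_zero_and_sha_two hp hp16 hm hm'0 hm' hpm' hm'8 hJ
  rw [(⟨0, -4 * (m : ℚ), 0, 2 * (m : ℚ) ^ 2, 0⟩ : WeierstrassCurve ℚ).selmerCorank_eq_mordellWeilRank_add_holds 2, hr,
    (⟨0, -4 * (m : ℚ), 0, 2 * (m : ℚ) ^ 2, 0⟩ : WeierstrassCurve ℚ).shaCorank_eq_zero_of_forall 2 hsha]

/-- **The Jacobi-symbol form of the hypothesis `(m′/p) = −1`**: for a prime `p` and `m′` with `jacobiSym m′ p = −1`, `m′` is a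
non-residue mod `p`. [cite: IrelandRosen1990, Ch. 5 §1 Prop. 5.1.2] -/
theorem not_isSquare_of_jacobiSym_eq_neg_one [Fact p.Prime] {m' : ℤ} (hJ : jacobiSym m' p = -1) :
    ¬ IsSquare (m' : ZMod p) := by
  rw [← jacobiSym.legendreSym.to_jacobiSym] at hJ
  exact (legendreSym.eq_neg_one_iff p).mp hJ

end RankZero

end Summit.BirchSwinnertonDyer.BirchSwinnertonDyer.Theorems.BiquadraticEisensteinDescentHeegnerTwistCouplingInSupplySqrtTwoCellFifteen

end
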